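import Mathlib
import HarnessLib
import Literature.MathematicalPhysics.QuantumLattice.FermiRG.BGM2003Sectors
import Summits.HubbardSuperconductivity.HubbardSuperconductivity.Theorems.KLProgrammeThinLevelSetGraphChart

/-!
# Route `KLProgramme` — K3 engine (stmt-HubbardSuperconductivity-20437), stub (b) (ℓ)/(I2)–(I3), located item «ABS-UMK-COUNT» / «UV-REMEASURE-COUNT»:
# lattice points in thin level sets, part 7 — the GRAPH CHART OF A UNIFORMLY CONVEX POLAR CURVE over a tangent direction

Cell gate-hubbard-kl, seat p4 g15 (model layer of HOME/prover-p4/UV-REMEASURE-COUNT.md §5).  A closed curve in polar form `P(θ) = r(θ)·e⃗_r(θ)`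
(`e⃗_r = dir`, `e⃗_t = tdir` of the tree; for BGM 2003's Fermi curve `r = u(·, 0)` and `P = BGM2003.fermiPoint u`) with `r, r′, r″` bounded and the
curvature numerator `r² + 2r′² − r·r″` (the numerator of `BGM2003.curvature`) bounded below by `D₀ > 0`, read near a base angle `θ⋆` in a frame
`(tdir α⋆, dir α⋆)` whose tangential axis sees the velocity `P′(θ⋆)` with component `≥ s₁ > 0` (for BGM's own frame `α⋆ = normalAngle`, that component
is the speed): tangential coordinate `U(φ) = (P(θ⋆+φ) − P(θ⋆))·tdir α⋆ = r sin ψ − r(θ⋆) sin ψ₀`, inward normal displacement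
`V(φ) = −(P(θ⋆+φ) − P(θ⋆))·dir α⋆` (`ψ = θ⋆ + φ − α⋆`).  On the parameter window `|φ| ≤ Φ` with `Φ·(R₀ + 2R₁ + R₂) ≤ s₁/2` one has `U′ ≥ s₁/2`, and
part 6 (`exists_inverse_graph`) yields the graph function `f = V ∘ U⁻¹`; the Wronskian identity `V″U′ − V′U″ = r² + 2r′² − r r″` makes
`f″ = (r² + 2r′² − r r″)/U′³`:

* `smul_dir_dotProduct_tdir` / `smul_dir_dotProduct_dir` — `(a·dir θ)·tdir α = a sin(θ − α)`, `(a·dir θ)·dir α = a cos(θ − α)`;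
* **`exists_polar_graph`** — `∃ f f′ f″`, `f` measurable, `f(U φ) = V φ` for `|φ| ≤ Φ`; on `|y| ≤ s₁Φ/4`: `HasDerivAt f (f′ y) y`, `HasDerivAt f′ (f″ y) y`,
  `D₀/(R₀+R₁)³ ≤ f″ y ≤ 8(R₀² + 2R₁² + R₀R₂)/s₁³`, `|f′ y| ≤ 2(R₀+R₁)/s₁`; and `U` is bi-Lipschitz on `[−Φ, Φ]` with constants `s₁/2`, `R₀ + R₁`
  — exactly the package `card_mul_sq_le_tripleSum_local` (part 5) consumes.

Everything is PROVED; no definitions, no named facts; generic calculus. [folklore]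
-/

noncomputable section

open Real Set Filter Topology
open Literature.MathematicalPhysics.QuantumLattice Literature.MathematicalPhysics.QuantumLattice.FermiRG

namespace Summit.HubbardSuperconductivity.HubbardSuperconductivity.Theorems.ThinLevelSet

set_option linter.dupNamespace false -- summit = problem name (single-conjunct summit), D-0017

/-! ## §1 Frame components of polar vectors and their derivatives -/

/-- `(a·e⃗_r(θ))·e⃗_t(α) = a·sin(θ − α)`. [folklore] -/
theorem smul_dir_dotProduct_tdir (a θ α : ℝ) : (a • dir θ) ⬝ᵥ tdir α = a * Real.sin (θ - α) := by
  simp [dotProduct, Fin.sum_univ_two, tdir, dir, Real.sin_sub]; ring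

/-- `(a·e⃗_r(θ))·e⃗_r(α) = a·cos(θ − α)`. [folklore] -/
theorem smul_dir_dotProduct_dir (a θ α : ℝ) : (a • dir θ) ⬝ᵥ dir α = a * Real.cos (θ - α) := by
  simp [dotProduct, Fin.sum_univ_two, dir, Real.cos_sub]; ring

/-- `d/dφ sin(θ⋆ + φ − α⋆) = cos(θ⋆ + φ − α⋆)`. [folklore] -/
theorem hasDerivAt_sin_shift (θs αs φ : ℝ) :
    HasDerivAt (fun φ => Real.sin (θs + φ - αs)) (Real.cos (θs + φ - αs)) φ := by
  have h : HasDerivAt (fun φ : ℝ => θs + φ - αs) 1 φ := by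
    simpa using ((hasDerivAt_id φ).const_add θs).sub_const αs
  have h2 := h.sin
  rw [mul_one] at h2
  exact h2

/-- `d/dφ cos(θ⋆ + φ − α⋆) = −sin(θ⋆ + φ − α⋆)`. [folklore] -/
theorem hasDerivAt_cos_shift (θs αs φ : ℝ) :
    HasDerivAt (fun φ => Real.cos (θs + φ - αs)) (-Real.sin (θs + φ - αs)) φ := by
  have h : HasDerivAt (fun φ : ℝ => θs + φ - αs) 1 φ := by
    simpa using ((hasDerivAt_id φ).const_add θs).sub_const αs
  have h2 := h.cos
  rw [mul_one] at h2
  exact h2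

/-- The Wronskian identity behind the curvature of a polar curve: with `U′ = r′ sin ψ + r cos ψ`, `V′ = −r′ cos ψ + r sin ψ`,
`U″ = r″ sin ψ + 2r′ cos ψ − r sin ψ`, `V″ = −r″ cos ψ + 2r′ sin ψ + r cos ψ`:
`V″U′ − V′U″ = r² + 2r′² − r r″`. [folklore] -/
theorem polar_wronskian (r r' r'' ψ : ℝ) :
    (-r'' * Real.cos ψ + 2 * r' * Real.sin ψ + r * Real.cos ψ) * (r' * Real.sin ψ + r * Real.cos ψ) -
      (-r' * Real.cos ψ + r * Real.sin ψ) * (r'' * Real.sin ψ + 2 * r' * Real.cos ψ - r * Real.sin ψ) =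
      r ^ 2 + 2 * r' ^ 2 - r * r'' := by
  have h := Real.sin_sq_add_cos_sq ψ
  linear_combination (r ^ 2 + 2 * r' ^ 2 - r * r'') * h

/-! ## §2 The graph chart of a polar curve -/

/-- **Graph chart of a uniformly convex polar curve over a tangent direction.**  Let `r : ℝ → ℝ` be twice differentiable with `|r| ≤ R₀`, `|r′| ≤ R₁`,
`|r″| ≤ R₂` and `r² + 2r′² − r r″ ≥ D₀ > 0` everywhere; fix a base angle `θ⋆`, a frame angle `α⋆` with
`r′(θ⋆) sin(θ⋆ − α⋆) + r(θ⋆) cos(θ⋆ − α⋆) ≥ s₁ > 0` (tangential component of the velocity), and a window `Φ > 0` with `Φ·(R₀ + 2R₁ + R₂) ≤ s₁/2`.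
With `U(φ) = (r(θ⋆+φ)e⃗_r(θ⋆+φ) − r(θ⋆)e⃗_r(θ⋆))·e⃗_t(α⋆)` and `V(φ) = −(r(θ⋆+φ)e⃗_r(θ⋆+φ) − r(θ⋆)e⃗_r(θ⋆))·e⃗_r(α⋆)` there are `f, f′, f″ : ℝ → ℝ`,
`f` measurable, such that: `f(U φ) = V φ` for `|φ| ≤ Φ`; for `|y| ≤ s₁Φ/4`: `HasDerivAt f (f′ y) y`, `HasDerivAt f′ (f″ y) y`,
`D₀/(R₀ + R₁)³ ≤ f″ y ≤ 8(R₀² + 2R₁² + R₀R₂)/s₁³`, `|f′ y| ≤ 2(R₀ + R₁)/s₁`; the two constants satisfy `0 < D₀/(R₀+R₁)³ ≤ 8(R₀² + 2R₁² + R₀R₂)/s₁³`;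
and `U` is bi-Lipschitz on `[−Φ, Φ]`: `(s₁/2)|φ − φ′| ≤ |U φ − U φ′| ≤ (R₀ + R₁)|φ − φ′|`, with `U 0 = 0`. [folklore] -/
theorem exists_polar_graph {r r' r'' : ℝ → ℝ} (hr : ∀ θ, HasDerivAt r (r' θ) θ) (hr' : ∀ θ, HasDerivAt r' (r'' θ) θ)
    {R₀ R₁ R₂ D₀ : ℝ} (hD₀ : 0 < D₀) (hrb : ∀ θ, |r θ| ≤ R₀) (hr'b : ∀ θ, |r' θ| ≤ R₁) (hr''b : ∀ θ, |r'' θ| ≤ R₂)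
    (hD : ∀ θ, D₀ ≤ r θ ^ 2 + 2 * r' θ ^ 2 - r θ * r'' θ)
    (θs αs : ℝ) {s₁ Φ : ℝ} (hs₁ : 0 < s₁) (hΦ : 0 < Φ)
    (hframe : s₁ ≤ r' θs * Real.sin (θs - αs) + r θs * Real.cos (θs - αs))
    (hΦM : Φ * (R₀ + 2 * R₁ + R₂) ≤ s₁ / 2) :
    ∃ f f' f'' : ℝ → ℝ, Measurable f ∧
      (∀ φ ∈ Icc (-Φ) Φ,
        f ((r (θs + φ) • dir (θs + φ) - r θs • dir θs) ⬝ᵥ tdir αs) = -((r (θs + φ) • dir (θs + φ) - r θs • dir θs) ⬝ᵥ dir αs)) ∧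
      (∀ y ∈ Icc (-(s₁ / 4 * Φ)) (s₁ / 4 * Φ), HasDerivAt f (f' y) y ∧ HasDerivAt f' (f'' y) y ∧
        D₀ / (R₀ + R₁) ^ 3 ≤ f'' y ∧ f'' y ≤ 8 * (R₀ ^ 2 + 2 * R₁ ^ 2 + R₀ * R₂) / s₁ ^ 3 ∧ |f' y| ≤ 2 * (R₀ + R₁) / s₁) ∧
      (0 < D₀ / (R₀ + R₁) ^ 3 ∧ D₀ / (R₀ + R₁) ^ 3 ≤ 8 * (R₀ ^ 2 + 2 * R₁ ^ 2 + R₀ * R₂) / s₁ ^ 3) ∧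
      (∀ φ ∈ Icc (-Φ) Φ, ∀ φ' ∈ Icc (-Φ) Φ,
        s₁ / 2 * |φ - φ'| ≤ |(r (θs + φ) • dir (θs + φ) - r θs • dir θs) ⬝ᵥ tdir αs - (r (θs + φ') • dir (θs + φ') - r θs • dir θs) ⬝ᵥ tdir αs| ∧
        |(r (θs + φ) • dir (θs + φ) - r θs • dir θs) ⬝ᵥ tdir αs - (r (θs + φ') • dir (θs + φ') - r θs • dir θs) ⬝ᵥ tdir αs| ≤ (R₀ + R₁) * |φ - φ'|) ∧
      ((r (θs + 0) • dir (θs + 0) - r θs • dir θs) ⬝ᵥ tdir αs = 0) := by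
  -- nonnegativity of the bound constants
  have hR₀ : 0 ≤ R₀ := (abs_nonneg _).trans (hrb θs)
  have hR₁ : 0 ≤ R₁ := (abs_nonneg _).trans (hr'b θs)
  have hR₂ : 0 ≤ R₂ := (abs_nonneg _).trans (hr''b θs)
  -- scalar form of the two coordinates
  set U : ℝ → ℝ := fun φ => r (θs + φ) * Real.sin (θs + φ - αs) - r θs * Real.sin (θs - αs) with hUdef
  set V : ℝ → ℝ := fun φ => -(r (θs + φ) * Real.cos (θs + φ - αs)) + r θs * Real.cos (θs - αs) with hVdef
  have hUeq : ∀ φ, (r (θs + φ) • dir (θs + φ) - r θs • dir θs) ⬝ᵥ tdir αs = U φ := fun φ => by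
    rw [sub_dotProduct, smul_dir_dotProduct_tdir, smul_dir_dotProduct_tdir, hUdef]
  have hVeq : ∀ φ, -((r (θs + φ) • dir (θs + φ) - r θs • dir θs) ⬝ᵥ dir αs) = V φ := fun φ => by
    rw [sub_dotProduct, smul_dir_dotProduct_dir, smul_dir_dotProduct_dir, hVdef]
    simp only; ring_nf
  set U' : ℝ → ℝ := fun φ => r' (θs + φ) * Real.sin (θs + φ - αs) + r (θs + φ) * Real.cos (θs + φ - αs) with hU'def
  set V' : ℝ → ℝ := fun φ => -(r' (θs + φ)) * Real.cos (θs + φ - αs) + r (θs + φ) * Real.sin (θs + φ - αs) with hV'def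
  set U'' : ℝ → ℝ := fun φ => r'' (θs + φ) * Real.sin (θs + φ - αs) + 2 * r' (θs + φ) * Real.cos (θs + φ - αs) -
    r (θs + φ) * Real.sin (θs + φ - αs) with hU''def
  set V'' : ℝ → ℝ := fun φ => -(r'' (θs + φ)) * Real.cos (θs + φ - αs) + 2 * r' (θs + φ) * Real.sin (θs + φ - αs) +
    r (θs + φ) * Real.cos (θs + φ - αs) with hV''def
  -- derivatives
  have hrs : ∀ φ, HasDerivAt (fun φ => r (θs + φ)) (r' (θs + φ)) φ := fun φ => HasDerivAt.comp_const_add θs φ (hr (θs + φ))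
  have hr's : ∀ φ, HasDerivAt (fun φ => r' (θs + φ)) (r'' (θs + φ)) φ := fun φ => HasDerivAt.comp_const_add θs φ (hr' (θs + φ))
  have hU : ∀ φ, HasDerivAt U (U' φ) φ := by
    intro φ
    have h := ((hrs φ).fun_mul (hasDerivAt_sin_shift θs αs φ)).sub_const (r θs * Real.sin (θs - αs))
    rw [hUdef, hU'def]
    exact h
  have hV : ∀ φ, HasDerivAt V (V' φ) φ := by
    intro φ
    have h := ((hrs φ).fun_mul (hasDerivAt_cos_shift θs αs φ)).fun_neg.add_const (r θs * Real.cos (θs - αs))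
    rw [hVdef, hV'def]
    refine h.congr_deriv ?_
    simp only
    ring
  have hU' : ∀ φ, HasDerivAt U' (U'' φ) φ := by
    intro φ
    have h := ((hr's φ).fun_mul (hasDerivAt_sin_shift θs αs φ)).fun_add ((hrs φ).fun_mul (hasDerivAt_cos_shift θs αs φ))
    rw [hU'def, hU''def]
    refine h.congr_deriv ?_
    simp only
    ring
  have hV' : ∀ φ, HasDerivAt V' (V'' φ) φ := by
    intro φ
    have h := (((hr's φ).fun_neg).fun_mul (hasDerivAt_cos_shift θs αs φ)).fun_add ((hrs φ).fun_mul (hasDerivAt_sin_shift θs αs φ))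
    rw [hV'def, hV''def]
    refine h.congr_deriv ?_
    simp only
    ring
  -- pointwise bounds
  have hsin : ∀ x, |Real.sin x| ≤ 1 := Real.abs_sin_le_one
  have hcos : ∀ x, |Real.cos x| ≤ 1 := Real.abs_cos_le_one
  have hU'b : ∀ φ, |U' φ| ≤ R₀ + R₁ := by
    intro φ
    rw [hU'def]; simp only
    have h1 : |r' (θs + φ) * Real.sin (θs + φ - αs)| ≤ R₁ := by
      rw [abs_mul]; exact (mul_le_of_le_one_right (abs_nonneg _) (hsin _)).trans (hr'b _)
    have h2 : |r (θs + φ) * Real.cos (θs + φ - αs)| ≤ R₀ := by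
      rw [abs_mul]; exact (mul_le_of_le_one_right (abs_nonneg _) (hcos _)).trans (hrb _)
    calc _ ≤ |r' (θs + φ) * Real.sin (θs + φ - αs)| + |r (θs + φ) * Real.cos (θs + φ - αs)| := abs_add_le _ _
      _ ≤ R₁ + R₀ := add_le_add h1 h2
      _ = R₀ + R₁ := add_comm _ _
  have hV'b : ∀ φ, |V' φ| ≤ R₀ + R₁ := by
    intro φ
    rw [hV'def]; simp only
    have h1 : |-(r' (θs + φ)) * Real.cos (θs + φ - αs)| ≤ R₁ := by
      rw [abs_mul, abs_neg]; exact (mul_le_of_le_one_right (abs_nonneg _) (hcos _)).trans (hr'b _)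
    have h2 : |r (θs + φ) * Real.sin (θs + φ - αs)| ≤ R₀ := by
      rw [abs_mul]; exact (mul_le_of_le_one_right (abs_nonneg _) (hsin _)).trans (hrb _)
    calc _ ≤ |-(r' (θs + φ)) * Real.cos (θs + φ - αs)| + |r (θs + φ) * Real.sin (θs + φ - αs)| := abs_add_le _ _
      _ ≤ R₁ + R₀ := add_le_add h1 h2
      _ = R₀ + R₁ := add_comm _ _
  have hU''b : ∀ φ, |U'' φ| ≤ R₀ + 2 * R₁ + R₂ := by
    intro φ
    rw [hU''def]; simp only
    have h1 : |r'' (θs + φ) * Real.sin (θs + φ - αs)| ≤ R₂ := by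
      rw [abs_mul]; exact (mul_le_of_le_one_right (abs_nonneg _) (hsin _)).trans (hr''b _)
    have h2 : |2 * r' (θs + φ) * Real.cos (θs + φ - αs)| ≤ 2 * R₁ := by
      rw [abs_mul, abs_mul, abs_two, mul_assoc]
      exact mul_le_mul_of_nonneg_left ((mul_le_of_le_one_right (abs_nonneg _) (hcos _)).trans (hr'b _)) zero_le_two
    have h3 : |r (θs + φ) * Real.sin (θs + φ - αs)| ≤ R₀ := by
      rw [abs_mul]; exact (mul_le_of_le_one_right (abs_nonneg _) (hsin _)).trans (hrb _)
    calc _ ≤ |r'' (θs + φ) * Real.sin (θs + φ - αs) + 2 * r' (θs + φ) * Real.cos (θs + φ - αs)| +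
          |r (θs + φ) * Real.sin (θs + φ - αs)| := abs_sub _ _
      _ ≤ (|r'' (θs + φ) * Real.sin (θs + φ - αs)| + |2 * r' (θs + φ) * Real.cos (θs + φ - αs)|) +
          |r (θs + φ) * Real.sin (θs + φ - αs)| := by gcongr; exact abs_add_le _ _
      _ ≤ (R₂ + 2 * R₁) + R₀ := add_le_add (add_le_add h1 h2) h3
      _ = R₀ + 2 * R₁ + R₂ := by ring
  have hDup : ∀ θ, r θ ^ 2 + 2 * r' θ ^ 2 - r θ * r'' θ ≤ R₀ ^ 2 + 2 * R₁ ^ 2 + R₀ * R₂ := by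
    intro θ
    have h1 : r θ ^ 2 ≤ R₀ ^ 2 := by
      have := hrb θ; rw [← sq_abs]; exact pow_le_pow_left₀ (abs_nonneg _) this 2
    have h2 : r' θ ^ 2 ≤ R₁ ^ 2 := by
      have := hr'b θ; rw [← sq_abs]; exact pow_le_pow_left₀ (abs_nonneg _) this 2
    have h3 : -(r θ * r'' θ) ≤ R₀ * R₂ := by
      have : |r θ * r'' θ| ≤ R₀ * R₂ := by
        rw [abs_mul]; exact mul_le_mul (hrb θ) (hr''b θ) (abs_nonneg _) hR₀
      have := neg_abs_le (r θ * r'' θ)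
      linarith
    linarith
  -- the window: `U′ ≥ s₁/2` on `[−Φ, Φ]`
  have hU'0 : s₁ ≤ U' 0 := by rw [hU'def]; simp only [add_zero]; exact hframe
  have hm' : ∀ φ ∈ Icc (-Φ) Φ, s₁ / 2 ≤ U' φ := by
    intro φ hφ
    have hlip := abs_sub_le_mul_abs_sub_of_hasDerivAt_le (a := -Φ) (b := Φ) (fun x _ => hU' x) (fun x _ => hU''b x)
      0 ⟨by linarith, hΦ.le⟩ φ hφ
    rw [sub_zero] at hlip
    have hφabs : |φ| ≤ Φ := abs_le.2 ⟨hφ.1, hφ.2⟩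
    have h1 : (R₀ + 2 * R₁ + R₂) * |φ| ≤ s₁ / 2 := by
      calc (R₀ + 2 * R₁ + R₂) * |φ| ≤ (R₀ + 2 * R₁ + R₂) * Φ := by gcongr
        _ = Φ * (R₀ + 2 * R₁ + R₂) := mul_comm _ _
        _ ≤ s₁ / 2 := hΦM
    have h2 := (abs_le.1 (hlip.trans h1)).1
    linarith
  have hm : (0 : ℝ) < s₁ / 2 := by linarith
  -- the inverse-function chart
  obtain ⟨f, f', f'', hfm, hval, himg, hder⟩ := exists_inverse_graph hΦ hm (fun x _ => hU x) (fun x _ => hU' x)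
    (fun x _ => hV x) (fun x _ => hV' x) hm'
  -- the Lipschitz directions of `U`
  have hlow := mul_sub_le_sub_of_hasDerivAt_ge (a := -Φ) (b := Φ) (fun x _ => hU x) hm'
  have hup := abs_sub_le_mul_abs_sub_of_hasDerivAt_le (a := -Φ) (b := Φ) (fun x _ => hU x) (fun x _ => hU'b x)
  have hU0 : U 0 = 0 := by rw [hUdef]; simp only [add_zero, sub_self]
  have h0mem : (0 : ℝ) ∈ Icc (-Φ) Φ := ⟨by linarith, hΦ.le⟩
  have hΦm : -Φ ∈ Icc (-Φ) Φ := ⟨le_rfl, by linarith⟩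
  have hΦp : Φ ∈ Icc (-Φ) Φ := ⟨by linarith, le_rfl⟩
  have hUΦ : s₁ / 2 * Φ ≤ U Φ := by have := hlow 0 h0mem Φ hΦp hΦ.le; rw [hU0] at this; linarith
  have hUΦ' : U (-Φ) ≤ -(s₁ / 2 * Φ) := by have := hlow (-Φ) hΦm 0 h0mem (by linarith); rw [hU0] at this; linarith
  -- constants
  have hM₁ : s₁ ≤ R₀ + R₁ := by
    have := hU'b 0; have h2 := le_abs_self (U' 0); linarith
  have hM₁pos : 0 < R₀ + R₁ := hs₁.trans_le hM₁
  have hcpos : 0 < D₀ / (R₀ + R₁) ^ 3 := div_pos hD₀ (pow_pos hM₁pos 3)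
  have hD₁ : D₀ ≤ R₀ ^ 2 + 2 * R₁ ^ 2 + R₀ * R₂ := (hD θs).trans (hDup θs)
  have hcA : D₀ / (R₀ + R₁) ^ 3 ≤ 8 * (R₀ ^ 2 + 2 * R₁ ^ 2 + R₀ * R₂) / s₁ ^ 3 := by
    rw [div_le_div_iff₀ (pow_pos hM₁pos 3) (pow_pos hs₁ 3)]
    have h1 : s₁ ^ 3 ≤ (R₀ + R₁) ^ 3 := pow_le_pow_left₀ hs₁.le hM₁ 3
    have h2 : 0 ≤ (R₀ + R₁) ^ 3 := pow_nonneg hM₁pos.le 3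
    have h3 : (0:ℝ) ≤ R₀ ^ 2 + 2 * R₁ ^ 2 + R₀ * R₂ := hD₀.le.trans hD₁
    calc D₀ * s₁ ^ 3 ≤ (R₀ ^ 2 + 2 * R₁ ^ 2 + R₀ * R₂) * (R₀ + R₁) ^ 3 := mul_le_mul hD₁ h1 (pow_nonneg hs₁.le 3) h3
      _ ≤ 8 * (R₀ ^ 2 + 2 * R₁ ^ 2 + R₀ * R₂) * (R₀ + R₁) ^ 3 := by nlinarith [mul_nonneg h3 h2]
  refine ⟨f, f', f'', hfm, ?_, ?_, ⟨hcpos, hcA⟩, ?_, ?_⟩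
  · -- values on the chart
    intro φ hφ
    rw [hUeq, hVeq]
    exact (hval φ hφ).1
  · -- derivatives and bounds on `|y| ≤ s₁Φ/4`
    intro y hy
    have hs4 : 0 < s₁ / 4 * Φ := by positivity
    have hyo : y ∈ Ioo (U (-Φ)) (U Φ) := ⟨by linarith [hy.1], by linarith [hy.2]⟩
    have hyc : y ∈ Icc (U (-Φ)) (U Φ) := Ioo_subset_Icc_self hyo
    obtain ⟨hd1, hd2⟩ := hder y hyo
    obtain ⟨x, hx, hUx, -, hf'y, hf''y⟩ := himg y hyc
    have hU'x : s₁ / 2 ≤ U' x := hm' x hx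
    have hU'pos : 0 < U' x := hm.trans_le hU'x
    have hU'le : U' x ≤ R₀ + R₁ := (le_abs_self _).trans (hU'b x)
    -- the Wronskian identity at `x`
    have hW : V'' x * U' x - V' x * U'' x = r (θs + x) ^ 2 + 2 * r' (θs + x) ^ 2 - r (θs + x) * r'' (θs + x) := by
      rw [hV''def, hU'def, hV'def, hU''def]; simp only
      have := polar_wronskian (r (θs + x)) (r' (θs + x)) (r'' (θs + x)) (θs + x - αs)
      linear_combination this
    have hDx := hD (θs + x)
    have hDxup := hDup (θs + x)
    refine ⟨hd1, hd2, ?_, ?_, ?_⟩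
    · -- floor of `f″`
      rw [hf''y, hW]
      have h1 : U' x ^ 3 ≤ (R₀ + R₁) ^ 3 := pow_le_pow_left₀ hU'pos.le hU'le 3
      have h2 : 0 < U' x ^ 3 := pow_pos hU'pos 3
      calc D₀ / (R₀ + R₁) ^ 3 ≤ D₀ / U' x ^ 3 := div_le_div_of_nonneg_left hD₀.le h2 h1
        _ ≤ _ := div_le_div_of_nonneg_right hDx h2.le
    · -- ceiling of `f″`
      rw [hf''y, hW]
      have h1 : (s₁ / 2) ^ 3 ≤ U' x ^ 3 := pow_le_pow_left₀ hm.le hU'x 3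
      have h2 : 0 < (s₁ / 2) ^ 3 := pow_pos hm 3
      have h3 : (0:ℝ) ≤ R₀ ^ 2 + 2 * R₁ ^ 2 + R₀ * R₂ := hD₀.le.trans hD₁
      calc (r (θs + x) ^ 2 + 2 * r' (θs + x) ^ 2 - r (θs + x) * r'' (θs + x)) / U' x ^ 3
          ≤ (R₀ ^ 2 + 2 * R₁ ^ 2 + R₀ * R₂) / U' x ^ 3 := div_le_div_of_nonneg_right hDxup (pow_pos hU'pos 3).le
        _ ≤ (R₀ ^ 2 + 2 * R₁ ^ 2 + R₀ * R₂) / (s₁ / 2) ^ 3 := div_le_div_of_nonneg_left h3 h2 h1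
        _ = 8 * (R₀ ^ 2 + 2 * R₁ ^ 2 + R₀ * R₂) / s₁ ^ 3 := by field_simp; ring
    · -- bound on `|f′|`
      rw [hf'y, abs_div, abs_of_pos hU'pos]
      rw [div_le_div_iff₀ hU'pos hs₁]
      calc |V' x| * s₁ ≤ (R₀ + R₁) * s₁ := by gcongr; exact hV'b x
        _ ≤ 2 * (R₀ + R₁) * U' x := by nlinarith [mul_nonneg hM₁pos.le (by linarith : 0 ≤ 2 * U' x - s₁)]
  · -- bi-Lipschitz
    intro φ hφ φ' hφ'
    rw [hUeq, hUeq]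
    constructor
    · rcases le_total φ' φ with h | h
      · have h1 := hlow φ' hφ' φ hφ h
        have h2 : 0 ≤ s₁ / 2 * (φ - φ') := mul_nonneg hm.le (by linarith)
        rw [abs_of_nonneg (by linarith : 0 ≤ φ - φ'), abs_of_nonneg (by linarith : 0 ≤ U φ - U φ')]
        linarith
      · have h1 := hlow φ hφ φ' hφ' h
        have h2 : 0 ≤ s₁ / 2 * (φ' - φ) := mul_nonneg hm.le (by linarith)
        rw [abs_of_nonpos (by linarith : φ - φ' ≤ 0), abs_of_nonpos (by linarith : U φ - U φ' ≤ 0)]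
        linarith
    · exact hup φ' hφ' φ hφ
  · -- `U 0 = 0`
    rw [hUeq]; exact hU0

end Summit.HubbardSuperconductivity.HubbardSuperconductivity.Theorems.ThinLevelSet

end
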